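import Summits.QuantumAdvantage.AdviceFreeQNC0.GatedCrossFree37
import HarnessLib

/-!
# Cell qa-qnc0 — GATED-LOCAL strategies: the rung `GatedLocalHardU k` / `SectionLocalHardU k` and its proved free-window case

(Part B of two.) Cell qa-qnc0, crux stmt-QuantumAdvantage-22907.  AUTHORED AND PROVED BY THE PLANNER qa-qnc0-p1 gen 36 (ROUND-35 §4.10 (5), evidence #47 on stmt-22907, file `HOME/qa-qnc0-p1/exp36/GatedLocal37.lean` v2, 469 lines, rc 0 / 0 sorries); landed verbatim by qn-prover-3 g21 as a two-way split: `GatedCrossFree37` (Part A, namespace `AdviceFreeQNC0`) → `GatedLocal37` (Part B, namespace `AffBells37G`).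

`gateVal ℓ u`, `GatedLocal r k y`, `GatedLocalHardU k` (OPEN rung), `sectionWins`, `card_wins_gated` (section identity), `SectionLocalHardU k` (OPEN),
`gatedLocalHardU_of_section`; PROVED CASE `gatedLocal_freeWindow_le` / `sectionWins_freeWindow_le`: if the gate forms all vanish on a stretch of
`gfree n C + 1` consecutive positions, the gated-local strategy loses a constant fraction (via Part A `ringWinU_gatedLocal_le`).  Hence the rung is
open only for polylog-DENSE gates.  WHAT THIS IS NOT: no bound for dense gates; crux untouched.
-/

noncomputable section

namespace Summit.QuantumAdvantage.AdviceFreeQNC0.AffBells37G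

open Classical
open Finset

variable {n : ℕ}

/-- the value of the 𝔽₃-linear form `ℓ` on the input `x(u)` (walk coordinates). -/
def gateVal (ℓ : Fin (n + 1) → ZMod 3) (u : Fin n → Bool) : ZMod 3 :=
  ∑ j : Fin (n + 1), if xOfU u j then ℓ j else 0

/-- `y` is GATED-LOCAL with window `r` and `k` gates: `y g u = G s g u` where `s` is the vector of gate values of `u`
and each `G s` is an `r`-window-local strategy. -/
def GatedLocal (r k : ℕ) (y : Fin (n + 1) → (Fin n → Bool) → Bool) : Prop :=
  ∃ (ℓ : Fin k → Fin (n + 1) → ZMod 3) (G : (Fin k → ZMod 3) → Fin (n + 1) → (Fin n → Bool) → Bool),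
    (∀ s, WindowLocal r (G s)) ∧ ∀ g u, y g u = G (fun i => gateVal (ℓ i) u) g u

/-- **`GatedLocalHardU k`** (the proposed next rung, `k = 1` first): gated-local strategies with `k` global MOD-3 gates
and polylog windows win the u-walk game (every charge) on at most `θ·2ⁿ` inputs, one `θ < 1` for all window exponents. -/
def GatedLocalHardU (k : ℕ) : Prop :=
  ∃ θ : ℝ, θ < 1 ∧ ∀ C : ℕ, ∃ n₀ : ℕ, ∀ n ≥ n₀, ∀ c : ℕ, ∀ y : Fin (n + 1) → (Fin n → Bool) → Bool,
    GatedLocal ((Nat.log 2 n) ^ C) k y →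
      ((univ.filter fun u : Fin n → Bool => ringWinU c y u = true).card : ℝ) ≤ θ * (2 : ℝ) ^ n

/-- wins of a strategy inside the MOD-3 section `{u : gate values = s}`. -/
def sectionWins (c : ℕ) {k : ℕ} (ℓ : Fin k → Fin (n + 1) → ZMod 3) (s : Fin k → ZMod 3)
    (z : Fin (n + 1) → (Fin n → Bool) → Bool) : ℕ :=
  (univ.filter fun u : Fin n → Bool => (fun i => gateVal (ℓ i) u) = s ∧ ringWinU c z u = true).card

/-- THE SECTION IDENTITY: the wins of the gated strategy are the section-wins of its local pieces. -/
theorem card_wins_gated (c : ℕ) {k : ℕ} (ℓ : Fin k → Fin (n + 1) → ZMod 3)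
    (G : (Fin k → ZMod 3) → Fin (n + 1) → (Fin n → Bool) → Bool) :
    (univ.filter fun u : Fin n → Bool => ringWinU c (fun g u => G (fun i => gateVal (ℓ i) u) g u) u = true).card =
      ∑ s : Fin k → ZMod 3, sectionWins c ℓ s (G s) := by
  unfold sectionWins
  rw [← Finset.card_biUnion]
  · congr 1
    ext u
    simp only [mem_filter, mem_univ, true_and, mem_biUnion]
    constructor
    · intro h
      refine ⟨fun i => gateVal (ℓ i) u, rfl, ?_⟩
      have : ringWinU c (G fun i => gateVal (ℓ i) u) u = ringWinU c (fun g u => G (fun i => gateVal (ℓ i) u) g u) u := by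
        unfold ringWinU; rfl
      rw [this]; exact h
    · rintro ⟨s, hs, h⟩
      subst hs
      have : ringWinU c (G fun i => gateVal (ℓ i) u) u = ringWinU c (fun g u => G (fun i => gateVal (ℓ i) u) g u) u := by
        unfold ringWinU; rfl
      rw [← this]; exact h
  · intro s _ s' _ hne
    rw [Function.onFun, disjoint_filter]
    intro u _ h1 h2
    exact hne (h1.1.symm.trans h2.1)

/-- «local rules cannot concentrate on one MOD-3 section»: the `k`-gate rung in section form. -/
def SectionLocalHardU (k : ℕ) : Prop :=
  ∃ θ : ℝ, θ < 1 ∧ ∀ C : ℕ, ∃ n₀ : ℕ, ∀ n ≥ n₀, ∀ c : ℕ, ∀ (ℓ : Fin k → Fin (n + 1) → ZMod 3)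
    (z : (Fin k → ZMod 3) → Fin (n + 1) → (Fin n → Bool) → Bool), (∀ s, WindowLocal ((Nat.log 2 n) ^ C) (z s)) →
      ((∑ s : Fin k → ZMod 3, sectionWins c ℓ s (z s) : ℕ) : ℝ) ≤ θ * (2 : ℝ) ^ n

/-- The section form of the rung implies the gated form (section identity `card_wins_gated`). -/
theorem gatedLocalHardU_of_section (k : ℕ) (h : SectionLocalHardU k) : GatedLocalHardU k := by
  obtain ⟨θ, hθ, hC⟩ := h
  refine ⟨θ, hθ, fun C => ?_⟩
  obtain ⟨n₀, hn₀⟩ := hC C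
  refine ⟨n₀, fun n hn c y hy => ?_⟩
  obtain ⟨ℓ, G, hG, hyG⟩ := hy
  have hy' : y = fun g u => G (fun i => gateVal (ℓ i) u) g u := funext fun g => funext fun u => hyG g u
  subst hy'
  rw [card_wins_gated]
  exact hn₀ n hn c ℓ G hG

/-! ### The proved case: gate forms vanishing on a stretch -/

/-- a linear form vanishing on the positions `p, …, p + w` is evaluated off the bits `[p, p + w)`. -/
theorem gateVal_eq_of_agree (ℓ : Fin (n + 1) → ZMod 3) (p w : ℕ)
    (hℓ : ∀ j : Fin (n + 1), p ≤ j.val → j.val ≤ p + w → ℓ j = 0) (u u' : Fin n → Bool)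
    (huu' : ∀ i : Fin n, ¬ (p ≤ i.val ∧ i.val < p + w) → u i = u' i) : gateVal ℓ u = gateVal ℓ u' := by
  unfold gateVal
  refine Finset.sum_congr rfl fun j _ => ?_
  by_cases hj : p ≤ j.val ∧ j.val ≤ p + w
  · rw [hℓ j hj.1 hj.2]; simp
  · have e1 : uExt u j.val = uExt u' j.val := by
      unfold uExt
      split_ifs with h
      · exact huu' _ (show ¬ (p ≤ j.val ∧ j.val < p + w) by omega)
      · rfl
    have e2 : j.val ≠ 0 → uExt u (j.val - 1) = uExt u' (j.val - 1) := by
      intro hj0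
      unfold uExt
      split_ifs with h
      · exact huu' _ (show ¬ (p ≤ j.val - 1 ∧ j.val - 1 < p + w) by omega)
      · rfl
    have hx : xOfU u j = xOfU u' j := by
      unfold xOfU
      rw [e1]
      by_cases hj0 : j.val = 0
      · rw [if_pos hj0, if_pos hj0]
      · rw [if_neg hj0, if_neg hj0, e2 hj0]
    rw [hx]

/-- **PROVED CASE OF THE RUNG (gated form).**  If every gate form vanishes on the positions `p, …, p + gfree n C`
(`p + gfree n C ≤ n`), the gated-local strategy wins on at most `θ·2ⁿ` inputs — the `θ` of `ringWinU_gatedLocal_le`,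
one for all `C` and all numbers of gates. -/
theorem gatedLocal_freeWindow_le :
    ∃ θ : ℝ, θ < 1 ∧ ∀ C : ℕ, ∃ n₀ : ℕ, ∀ n ≥ n₀, ∀ (c k : ℕ) (ℓ : Fin k → Fin (n + 1) → ZMod 3)
      (G : (Fin k → ZMod 3) → Fin (n + 1) → (Fin n → Bool) → Bool) (p : ℕ), p + gfree n C ≤ n →
        (∀ i, ∀ j : Fin (n + 1), p ≤ j.val → j.val ≤ p + gfree n C → ℓ i j = 0) →
        (∀ s, WindowLocal ((Nat.log 2 n) ^ C) (G s)) →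
          ((univ.filter fun u : Fin n → Bool =>
              ringWinU c (fun g u => G (fun i => gateVal (ℓ i) u) g u) u = true).card : ℝ) ≤
            θ * (2 : ℝ) ^ n := by
  obtain ⟨θ, hθ, H⟩ := ringWinU_gatedLocal_le
  refine ⟨θ, hθ, fun C => ?_⟩
  obtain ⟨n₀, hn₀⟩ := H C
  refine ⟨n₀, fun n hn c k ℓ G p hp hℓ hloc => ?_⟩
  refine hn₀ n hn c (Fin k → ZMod 3) (fun u i => gateVal (ℓ i) u) G p hp ?_ hloc
  intro u u' huu'
  funext i
  exact gateVal_eq_of_agree (ℓ i) p (gfree n C) (hℓ i) u u' huu'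

/-- **PROVED CASE OF THE RUNG (section form).**  `SectionLocalHardU k` restricted to gate forms with a common
zero stretch of `gfree n C + 1` positions. -/
theorem sectionWins_freeWindow_le :
    ∃ θ : ℝ, θ < 1 ∧ ∀ C : ℕ, ∃ n₀ : ℕ, ∀ n ≥ n₀, ∀ (c k : ℕ) (ℓ : Fin k → Fin (n + 1) → ZMod 3)
      (z : (Fin k → ZMod 3) → Fin (n + 1) → (Fin n → Bool) → Bool) (p : ℕ), p + gfree n C ≤ n →
        (∀ i, ∀ j : Fin (n + 1), p ≤ j.val → j.val ≤ p + gfree n C → ℓ i j = 0) →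
        (∀ s, WindowLocal ((Nat.log 2 n) ^ C) (z s)) →
          ((∑ s : Fin k → ZMod 3, sectionWins c ℓ s (z s) : ℕ) : ℝ) ≤ θ * (2 : ℝ) ^ n := by
  obtain ⟨θ, hθ, H⟩ := gatedLocal_freeWindow_le
  refine ⟨θ, hθ, fun C => ?_⟩
  obtain ⟨n₀, hn₀⟩ := H C
  refine ⟨n₀, fun n hn c k ℓ z p hp hℓ hloc => ?_⟩
  rw [← card_wins_gated]
  exact hn₀ n hn c k ℓ z p hp hℓ hloc

end Summit.QuantumAdvantage.AdviceFreeQNC0.AffBells37G
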